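import Summits.ValiantsHypothesis.ValiantsHypothesis.Theorems.KPlusLogSqLawTropicalBTopHeavyCoreBudget

/-!
# Route «KPlusLogSqLaw», crux `TropicalB` (stmt-ValiantsHypothesis-19771) — THE TRANSVERSAL LAW IN SUM FORM (toolkit for multi-column transfers):
# any injective selector «`σC` off `U`, `σB` on `U ∖ J`, `σA` on `J`» plus ONE sum inequality for the earliest term is contradictory

HONEST FRAMING.  Toolkit extraction (val-sym-trop-p1 g21, cell `pub-symmetroid`, 2026-08-28; `--supports stmt-ValiantsHypothesis-19771 --as helper`) from
this seat's one-column transfer law (…TopHeavyCoreBudget / …General / …Arc).  Those files prove the 3-body assembly for the ONE-JUMP transversal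
(`J = {j}`) under pointwise class hypotheses; the proof uses the class hypotheses only through ONE inequality between exponent sums — of the transversal
term and of the EARLIEST of `P_A`, `P_B`.  Here that is made the hypothesis, for an arbitrary «`A`-set» `J ⊆ U`:
* `core_of_transversal` — `P_C = (σC, λC)` latest with `λC ≡ c₀` off one column `c ∈ U`, `d c₀ ≤ d (λC ·)`, `d c₀ < d (λA ·)`, `d c₀ < d (λB ·)`;
  `U ≠ univ`; the selector «`σC` off `U`, `σB` on `U ∖ J`, `σA` on `J`» injective; and
  `θA < θB ⇒ Σ_{U∖J} d λB + |Uᶜ|·d c₀ ≤ Σ_{U∖J} d λA + Σ_{Uᶜ} d λA`,  `θB < θA ⇒ Σ_J d λA + |Uᶜ|·d c₀ ≤ Σ_J d λB + Σ_{Uᶜ} d λB`  ⇒ `False`.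
* `oneJump_injective` — the one-jump selector (`J = {j}`, `U` = the `σC⁻¹σB`-arc from `σC⁻¹σA j` to `j`) is injective: the generic part of
  `core_law_budget`, stated on its own (with `exists_arcFamily`, `exists_arc`, `cover_eq` of …TopHeavyCoreArc this is the whole arc toolkit).
WHY.  The located «(2,2) → (1,3) transfer conjecture» (memo CORE-LAW-C-g21 §6; ktight: every arrangement infeasible for `m ≤ 5`, 0 counterexamples in
38 random exponent vectors at `m = 5`, tools/coreTransfer5.log) is proved only in its ALIGNED case (`transfer_aligned`); the remaining arrangements have
TWO raised columns, where a proof must choose the arc (or a larger `J`) using the sums, not pointwise domination — this file is the interface for that.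
Nothing here bears on `TropicalB` in its window, `WeakLifting`, DoorA26 / DoorA34, `MatrixDescartes` (stmt-ValiantsHypothesis-18050) or VP ≠ VNP.
[this cell; combinatorics folklore]
-/

set_option linter.dupNamespace false
set_option autoImplicit false

namespace Summit.ValiantsHypothesis.ValiantsHypothesis.Theorems.KPlusLogSqLaw.TopHeavyCore

open Summit.ValiantsHypothesis.ValiantsHypothesis.Theorems.MatrixDescartes.Negative
open Summit.ValiantsHypothesis.ValiantsHypothesis.Theorems.KPlusLogSqLaw.LexCore
open scoped BigOperators
open Finset

variable {m K : ℕ}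

/-! ## 1. The 3-body assembly for an arbitrary `A`-set `J ⊆ U`, hypotheses in sum form -/

/-- **TRANSVERSAL LAW, SUM FORM.**  See the module docstring. [this cell] -/
theorem core_of_transversal (d : Fin K → ℕ) (v ε : Fin m → Fin m → Fin K → ℤ) (hm : 2 ≤ m)
    {c₀ : Fin K} {σA σB σC : Equiv.Perm (Fin m)} {lA lB lC : Fin m → Fin K} {c : Fin m}
    (hlC : ∀ x, x ≠ c → lC x = c₀) (hCge : ∀ x, d c₀ ≤ d (lC x)) (hlowA : ∀ x, d c₀ < d (lA x)) (hlowB : ∀ x, d c₀ < d (lB x))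
    {θA θB θC : ℤ} (hA : IsDominant d v ε θA (σA, lA)) (hB : IsDominant d v ε θB (σB, lB)) (hC : IsDominant d v ε θC (σC, lC))
    (hAC : θA < θC) (hBC : θB < θC) (hAB : θA ≠ θB)
    (U J : Finset (Fin m)) (hJU : J ⊆ U) (hcU : c ∈ U) (hUne : U ≠ univ)
    (hinj : Function.Injective fun x => if x ∈ U then (if x ∈ J then σA x else σB x) else σC x)
    (hsumA : θA < θB → ∑ x ∈ U \ J, (d (lB x) : ℤ) + ∑ _x ∈ Uᶜ, (d c₀ : ℤ) ≤ ∑ x ∈ U \ J, (d (lA x) : ℤ) + ∑ x ∈ Uᶜ, (d (lA x) : ℤ))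
    (hsumB : θB < θA → ∑ x ∈ J, (d (lA x) : ℤ) + ∑ _x ∈ Uᶜ, (d c₀ : ℤ) ≤ ∑ x ∈ J, (d (lB x) : ℤ) + ∑ x ∈ Uᶜ, (d (lB x) : ℤ)) : False := by
  classical
  -- a column outside `U`
  obtain ⟨x₀, hx₀⟩ : ∃ x, x ∉ U := by
    by_contra h; push Not at h; exact hUne (Finset.eq_univ_of_forall h)
  -- quotients against `C` are fixed-point free
  have hfA := (hamiltonian_AC d v ε hAC hA hC c (c₀ := c₀) hlC hlowA hm).1
  have hfB := (hamiltonian_AC d v ε hBC hB hC c (c₀ := c₀) hlC hlowB hm).1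
  have hCA : ∀ x, σC x ≠ σA x := fun x h => hfA x (by
    rw [Equiv.Perm.mul_apply, Equiv.Perm.inv_eq_iff_eq]; exact h)
  have hCB : ∀ x, σC x ≠ σB x := fun x h => hfB x (by
    rw [Equiv.Perm.mul_apply, Equiv.Perm.inv_eq_iff_eq]; exact h)
  -- order the three terms: `T 2 = C`, `T iA = A`, `T iB = B`, remembering which of `A`, `B` is the earliest
  obtain ⟨iA, iB, T, θ3, hT2, hTA, hTB, hiA2, hiB2, hiAB, hθ01, hθ12, hdomT, hfirstA, hfirstB⟩ :
      ∃ (iA iB : Fin 3) (T : Fin 3 → Equiv.Perm (Fin m) × (Fin m → Fin K)) (θ3 : Fin 3 → ℤ),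
        T 2 = (σC, lC) ∧ T iA = (σA, lA) ∧ T iB = (σB, lB) ∧ iA ≠ 2 ∧ iB ≠ 2 ∧ iA ≠ iB ∧ θ3 0 < θ3 1 ∧ θ3 1 < θ3 2 ∧
        (∀ k, IsDominant d v ε (θ3 k) (T k)) ∧ ((0 : Fin 3) = iA → θA < θB) ∧ ((0 : Fin 3) = iB → θB < θA) := by
    rcases lt_or_gt_of_ne hAB with hlt | hgt
    · refine ⟨0, 1, ![(σA, lA), (σB, lB), (σC, lC)], ![θA, θB, θC], rfl, rfl, rfl, by decide, by decide, by decide, ?_, ?_, ?_,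
        fun _ => hlt, fun h => absurd h (by decide)⟩
      · simpa using hlt
      · simpa using hBC
      · intro k; fin_cases k <;> simpa
    · refine ⟨1, 0, ![(σB, lB), (σA, lA), (σC, lC)], ![θB, θA, θC], rfl, rfl, rfl, by decide, by decide, by decide, ?_, ?_, ?_,
        fun h => absurd h (by decide), fun _ => hgt⟩
      · simpa using hgt
      · simpa using hAC
      · intro k; fin_cases k <;> simpa
  -- the selector
  let s₀ : Fin m → Fin 3 := fun x => if x ∈ U then (if x ∈ J then iA else iB) else 2
  have hs₀row : ∀ x, (T (s₀ x)).1 x = (if x ∈ U then (if x ∈ J then σA x else σB x) else σC x) := by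
    intro x
    by_cases hx : x ∈ U
    · by_cases hxj : x ∈ J
      · simp only [s₀, if_pos hx, if_pos hxj, hTA]
      · simp only [s₀, if_pos hx, if_neg hxj, hTB]
    · simp only [s₀, if_neg hx, hT2]
  have hs₀cls : ∀ x, (T (s₀ x)).2 x = (if x ∈ U then (if x ∈ J then lA x else lB x) else lC x) := by
    intro x
    by_cases hx : x ∈ U
    · by_cases hxj : x ∈ J
      · simp only [s₀, if_pos hx, if_pos hxj, hTA]
      · simp only [s₀, if_pos hx, if_neg hxj, hTB]
    · simp only [s₀, if_neg hx, hT2]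
  have hi₀ : Function.Injective fun x => (T (s₀ x)).1 x := by
    have : (fun x => (T (s₀ x)).1 x) = fun x => if x ∈ U then (if x ∈ J then σA x else σB x) else σC x := funext hs₀row
    rw [this]; exact hinj
  -- rows of the three terms are injective
  have hr : ∀ s, Function.Injective fun x => (T s).1 x := fun s => (T s).1.injective
  -- Kőnig: split the free incidences
  obtain ⟨s₁', s₂', h1M, h2M, h12', hi₁', hi₂'⟩ := LexCore.two_factor (fun s x => (T s).1 x) hr s₀ hi₀
  -- arrange that the second free transversal takes `C`'s cell at column `c`
  obtain ⟨s₁, s₂, h01s, h02s, h12s, hi₁, hi₂, hs₂c⟩ : ∃ s₁ s₂ : Fin m → Fin 3, (∀ x, s₀ x ≠ s₁ x) ∧ (∀ x, s₀ x ≠ s₂ x) ∧ (∀ x, s₁ x ≠ s₂ x) ∧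
      Function.Injective (fun x => (T (s₁ x)).1 x) ∧ Function.Injective (fun x => (T (s₂ x)).1 x) ∧ s₂ c = 2 := by
    have hs₀c : s₀ c ≠ 2 := by
      simp only [s₀, if_pos hcU]; split_ifs <;> assumption
    by_cases h2 : s₂' c = 2
    · exact ⟨s₁', s₂', fun x => (h1M x).symm, fun x => (h2M x).symm, h12', hi₁', hi₂', h2⟩
    · have h1 : s₁' c = 2 := fin3_third (s₀ c) (s₁' c) (s₂' c) (h1M c) (h2M c) (h12' c) hs₀c h2
      exact ⟨s₂', s₁', fun x => (h2M x).symm, fun x => (h1M x).symm, fun x => (h12' x).symm, hi₂', hi₁', h1⟩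
  -- `Q₀ ≠ T 0` at the column `x₀ ∉ U`
  have hneQ : ∃ x, (T (s₀ x)).1 x ≠ (T 0).1 x := by
    refine ⟨x₀, ?_⟩
    rw [hs₀row x₀, if_neg hx₀]
    have h0 : (0 : Fin 3) = iA ∨ (0 : Fin 3) = iB := fin3_zero iA iB hiA2 hiB2 hiAB
    rcases h0 with h | h
    · rw [h, hTA]; exact hCA x₀
    · rw [h, hTB]; exact hCB x₀
  -- the exponent sum of `Q₀`, split over `J`, `U ∖ J`, `Uᶜ`
  have hQsum : ∑ x, (d ((T (s₀ x)).2 x) : ℤ) =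
      ∑ x ∈ J, (d (lA x) : ℤ) + ∑ x ∈ U \ J, (d (lB x) : ℤ) + ∑ _x ∈ Uᶜ, (d c₀ : ℤ) := by
    rw [← Finset.sum_add_sum_compl U, ← Finset.sum_sdiff hJU]
    have e1 : ∑ x ∈ U \ J, (d ((T (s₀ x)).2 x) : ℤ) = ∑ x ∈ U \ J, (d (lB x) : ℤ) :=
      Finset.sum_congr rfl fun x hx => by
        have hxU : x ∈ U := (Finset.mem_sdiff.mp hx).1
        have hxJ : x ∉ J := (Finset.mem_sdiff.mp hx).2
        rw [hs₀cls x, if_pos hxU, if_neg hxJ]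
    have e2 : ∑ x ∈ J, (d ((T (s₀ x)).2 x) : ℤ) = ∑ x ∈ J, (d (lA x) : ℤ) :=
      Finset.sum_congr rfl fun x hx => by rw [hs₀cls x, if_pos (hJU hx), if_pos hx]
    have e3 : ∑ x ∈ Uᶜ, (d ((T (s₀ x)).2 x) : ℤ) = ∑ _x ∈ Uᶜ, (d c₀ : ℤ) :=
      Finset.sum_congr rfl fun x hx => by
        have hxU : x ∉ U := Finset.mem_compl.mp hx
        have hxc : x ≠ c := fun h => hxU (h ▸ hcU)
        rw [hs₀cls x, if_neg hxU, hlC x hxc]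
    rw [e1, e2, e3]; ring
  have hsplit : ∀ f : Fin m → ℤ, ∑ x, f x = ∑ x ∈ J, f x + ∑ x ∈ U \ J, f x + ∑ x ∈ Uᶜ, f x := by
    intro f
    rw [← Finset.sum_add_sum_compl U, ← Finset.sum_sdiff hJU]; ring
  -- domination of `Q₀` by the earliest term, in sum
  have hP1 : ∑ x, (d ((T (s₀ x)).2 x) : ℤ) ≤ ∑ x, (d ((T 0).2 x) : ℤ) := by
    have h0 : (0 : Fin 3) = iA ∨ (0 : Fin 3) = iB := fin3_zero iA iB hiA2 hiB2 hiAB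
    rcases h0 with h | h
    · -- earliest term is `A`
      have hlt := hfirstA h
      rw [h, hTA, hQsum, hsplit (fun x => (d (lA x) : ℤ))]
      have := hsumA hlt
      linarith
    · -- earliest term is `B`
      have hgt := hfirstB h
      rw [h, hTB, hQsum, hsplit (fun x => (d (lB x) : ℤ))]
      have := hsumB hgt
      linarith
  -- domination of the last term by the transversal through `C`'s cell at `c`, pointwise
  have hP2 : ∑ x, (d ((T 2).2 x) : ℤ) ≤ ∑ x, (d ((T (s₂ x)).2 x) : ℤ) := by
    refine Finset.sum_le_sum fun x _ => ?_
    rw [hT2]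
    by_cases hxc : x = c
    · subst hxc; rw [hs₂c, hT2]
    · simp only
      rw [hlC x hxc]
      rcases fin3_cases_two iA iB hiA2 hiB2 hiAB (s₂ x) with h | h | h
      · rw [h, hTA]; exact_mod_cast (hlowA x).le
      · rw [h, hTB]; exact_mod_cast (hlowB x).le
      · rw [h, hT2]; exact_mod_cast hCge x
  exact latin_contra_sum d v ε T θ3 hθ01 hθ12 hdomT s₀ s₁ s₂ h01s h02s h12s hi₀ hi₁ hi₂ hneQ hP1 hP2

/-! ## 2. The one-jump selector is injective -/

/-- **the one-jump transversal is injective.**  `P = σC⁻¹σB` fixed-point free with one cycle class, `τ = σA⁻¹σB`, `U` a `P`-arc with the arc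
properties of `exists_arcFamily` at `j` (`j ∈ U`, `P (τ⁻¹ j) ∈ U`, `τ⁻¹ j ∉ U`, `U ∖ {j}` mapped into `U` by `P`): the column-to-row map «`σC` off `U`,
`σB` on `U ∖ {j}`, `σA` at `j`» is injective. [this cell] -/
theorem oneJump_injective {σA σB σC : Equiv.Perm (Fin m)} {P τ : Equiv.Perm (Fin m)} (hP : P = σC⁻¹ * σB) (hτ : τ = σA⁻¹ * σB)
    {U : Finset (Fin m)} {j : Fin m} (hfirst : P (τ⁻¹ j) ∈ U) (hstart : τ⁻¹ j ∉ U) (hstep : ∀ x, x ∈ U → x ≠ j → P x ∈ U) :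
    Function.Injective fun x => if x ∈ U then (if x = j then σA x else σB x) else σC x := by
  classical
  have hτinv : ∀ x, τ⁻¹ x = σB⁻¹ (σA x) := fun x => by rw [hτ, mul_inv_rev, inv_inv, Equiv.Perm.mul_apply]
  have hPB : ∀ x, σC (P x) = σB x := fun x => by rw [hP, Equiv.Perm.mul_apply]; simp
  have hQA : σC (P (τ⁻¹ j)) = σA j := by rw [hPB, hτinv]; simp
  let g : Fin m → Fin m := fun x => if x ∈ U then (if x = j then P (τ⁻¹ j) else P x) else x
  have hfg : ∀ x, (if x ∈ U then (if x = j then σA x else σB x) else σC x) = σC (g x) := by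
    intro x
    by_cases hx : x ∈ U
    · by_cases hxj : x = j
      · simp only [g, if_pos hx, if_pos hxj]; rw [hxj, hQA]
      · simp only [g, if_pos hx, if_neg hxj]; rw [hPB]
    · simp only [g, if_neg hx]
  have hgU : ∀ x, x ∈ U → g x ∈ U := by
    intro x hx
    by_cases hxj : x = j
    · simp only [g, if_pos hx, if_pos hxj]; exact hfirst
    · simp only [g, if_pos hx, if_neg hxj]; exact hstep x hx hxj
  have hgU' : ∀ x, x ∉ U → g x = x := fun x hx => by simp only [g, if_neg hx]
  have hginj : Function.Injective g := by
    intro x y hxy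
    by_cases hx : x ∈ U
    · by_cases hy : y ∈ U
      · by_cases hxj : x = j
        · by_cases hyj : y = j
          · rw [hxj, hyj]
          · exfalso
            have e : P (τ⁻¹ j) = P y := by simpa only [g, if_pos hx, if_pos hxj, if_pos hy, if_neg hyj] using hxy
            have : τ⁻¹ j = y := P.injective e
            exact hstart (this ▸ hy)
        · by_cases hyj : y = j
          · exfalso
            have e : P x = P (τ⁻¹ j) := by simpa only [g, if_pos hx, if_neg hxj, if_pos hy, if_pos hyj] using hxy
            have : x = τ⁻¹ j := P.injective e
            exact hstart (this ▸ hx)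
          · have e : P x = P y := by simpa only [g, if_pos hx, if_neg hxj, if_pos hy, if_neg hyj] using hxy
            exact P.injective e
      · exfalso; apply hy; rw [← hgU' y hy, ← hxy]; exact hgU x hx
    · by_cases hy : y ∈ U
      · exfalso; apply hx; rw [← hgU' x hx, hxy]; exact hgU y hy
      · rw [← hgU' x hx, ← hgU' y hy, hxy]
  intro x y hxy
  have : σC (g x) = σC (g y) := by rw [← hfg x, ← hfg y]; exact hxy
  exact hginj (σC.injective this)

end Summit.ValiantsHypothesis.ValiantsHypothesis.Theorems.KPlusLogSqLaw.TopHeavyCore
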